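import Mathlib
import HarnessLib

/-!
# Exponentially small left tails `∫_{(−∞,x]} h` and their primitives

Topic `Literature/Analysis/ODE` (namespace `Literature.Analysis.ODE`).  Elementary tool of asymptotic
integration at a regular end where the coefficient is exponentially small (Hartman, *Ordinary
Differential Equations*, Ch. X §1, "integration of `y'' = f`" with `∫^∞ |f| < ∞`; here at the LEFT
end `x → −∞`, the horizon end of the Schwarzschild tortoise line): the **left tail primitive**
`x ↦ ∫_{(−∞, x]} h` of a continuous function with an exponential bound `|h(s)| ≤ C e^{λ s}`
(`λ > 0`) on a half-line `(−∞, X]`.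

* `leftTail_integrableOn` — such `h` is integrable on every `(−∞, x]`;
* `abs_leftTail_le` — `|∫_{(−∞,x]} h| ≤ (C/λ) e^{λ x}` for `x ≤ X`;
* `hasDerivAt_leftTail`, `continuous_leftTail` — the tail primitive is a `C¹` primitive of `h`
  (everywhere, for `h` continuous on `ℝ`), and the same for the double tail `∫∫ h`
  (`abs_leftTail2_le`, `hasDerivAt_leftTail2`, `continuous_leftTail2`);
* `exists_affine_add_leftTail2` — a function with `u'' = h` on an open half-line `(−∞, X')` is
  `α + β x + ∫∫ h` there (two constants of integration);
* bookkeeping of exponential bounds (`mul_exp_le_mul_exp_of_rate_le`, `abs_add_le_mul_exp`,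
  `abs_mul_le_mul_exp_add`).

Functions are taken continuous on all of `ℝ` (callers clamp half-line data with `min · X'`);
bounds are only assumed and concluded on half-lines.  Used by `PolyharmonicHalfLine.lean`
(Liouville theorem for `(∂² − V)`-polyharmonic functions square-integrable at `−∞`).  Everything is
proved; no definitions.

## References

* P. Hartman, *Ordinary Differential Equations*, SIAM Classics 38 (2002), Ch. X §1, §17
  (key `Hartman2002`).
-/

namespace Literature.Analysis.ODE

open _root_.MeasureTheory _root_.Set _root_.Filter _root_.Topology intervalIntegral

noncomputable section

/-! ### Integrability and size of exponentially small tails -/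

/-- A continuous function with `|h s| ≤ C e^{λ s}` on `(−∞, X]` (`λ > 0`) is integrable on
`(−∞, x]` for every `x ≤ X`. [folklore] -/
theorem leftTail_integrableOn_of_le {h : ℝ → ℝ} {X C lam : ℝ} (hlam : 0 < lam)
    (hc : Continuous h) (hb : ∀ s ≤ X, |h s| ≤ C * Real.exp (lam * s)) {x : ℝ} (hx : x ≤ X) :
    IntegrableOn h (Iic x) := by
  have hdom : IntegrableOn (fun s => C * Real.exp (lam * s)) (Iic x) :=
    (integrableOn_exp_mul_Iic hlam x).const_mul C
  refine Integrable.mono' hdom hc.aestronglyMeasurable.restrict ?_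
  refine (ae_restrict_iff' measurableSet_Iic).2 (Eventually.of_forall fun s hs => ?_)
  rw [Real.norm_eq_abs]
  exact hb s ((mem_Iic.1 hs).trans hx)

/-- A continuous function is integrable on `(−∞, x]` for EVERY `x` as soon as it has an
exponential bound on some half-line `(−∞, X]`. [folklore] -/
theorem leftTail_integrableOn {h : ℝ → ℝ} {X C lam : ℝ} (hlam : 0 < lam)
    (hc : Continuous h) (hb : ∀ s ≤ X, |h s| ≤ C * Real.exp (lam * s)) (x : ℝ) :
    IntegrableOn h (Iic x) := by
  rcases le_total x X with hx | hx
  · exact leftTail_integrableOn_of_le hlam hc hb hx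
  · have h1 : IntegrableOn h (Iic X) := leftTail_integrableOn_of_le hlam hc hb le_rfl
    have h2 : IntegrableOn h (Icc X x) := hc.integrableOn_Icc
    have : Iic x = Iic X ∪ Icc X x := by
      ext s
      simp only [mem_Iic, mem_union, mem_Icc]
      constructor
      · intro hs
        rcases le_total s X with h | h
        · exact Or.inl h
        · exact Or.inr ⟨h, hs⟩
      · rintro (h | ⟨_, h⟩)
        · exact h.trans hx
        · exact h
    rw [this]
    exact h1.union h2

/-- **Size of an exponentially small tail**: `|∫_{(−∞,x]} h| ≤ (C/λ) e^{λ x}` for `x ≤ X`. [folklore] -/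
theorem abs_leftTail_le {h : ℝ → ℝ} {X C lam : ℝ} (hlam : 0 < lam)
    (hc : Continuous h) (hb : ∀ s ≤ X, |h s| ≤ C * Real.exp (lam * s)) {x : ℝ} (hx : x ≤ X) :
    |∫ s in Iic x, h s| ≤ C / lam * Real.exp (lam * x) := by
  have hint := leftTail_integrableOn_of_le hlam hc hb hx
  have hdom : IntegrableOn (fun s => C * Real.exp (lam * s)) (Iic x) :=
    (integrableOn_exp_mul_Iic hlam x).const_mul C
  calc |∫ s in Iic x, h s| ≤ ∫ s in Iic x, |h s| := by
        simpa only [← Real.norm_eq_abs] using norm_integral_le_integral_norm h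
    _ ≤ ∫ s in Iic x, C * Real.exp (lam * s) := by
        refine setIntegral_mono_on hint.abs hdom measurableSet_Iic fun s hs => ?_
        exact hb s ((mem_Iic.1 hs).trans hx)
    _ = C / lam * Real.exp (lam * x) := by
        rw [MeasureTheory.integral_const_mul, integral_exp_mul_Iic hlam]
        ring

/-! ### The tail primitive is a `C¹` primitive -/

/-- **The tail primitive is a primitive**: `d/dx ∫_{(−∞,x]} h = h(x)` at every `x`, for `h`
continuous on `ℝ` with an exponential bound on some `(−∞, X]`. [folklore] -/
theorem hasDerivAt_leftTail {h : ℝ → ℝ} {X C lam : ℝ} (hlam : 0 < lam)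
    (hc : Continuous h) (hb : ∀ s ≤ X, |h s| ≤ C * Real.exp (lam * s)) (x : ℝ) :
    HasDerivAt (fun y => ∫ s in Iic y, h s) (h x) x := by
  have hI := leftTail_integrableOn hlam hc hb
  -- `∫_{Iic y} h = ∫_{Iic (x-1)} h + ∫_{x-1}^y h`
  have heq : (fun y => ∫ s in Iic y, h s)
      = fun y => (∫ s in Iic (x - 1), h s) + ∫ s in (x - 1)..y, h s := by
    funext y
    have := integral_Iic_sub_Iic (hI (x - 1)) (hI y)
    linarith
  rw [heq]
  have hF := integral_hasDerivAt_right (hc.intervalIntegrable (x - 1) x)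
    (hc.stronglyMeasurableAtFilter _ _) hc.continuousAt
  exact hF.const_add _

/-- The tail primitive is continuous. [folklore] -/
theorem continuous_leftTail {h : ℝ → ℝ} {X C lam : ℝ} (hlam : 0 < lam)
    (hc : Continuous h) (hb : ∀ s ≤ X, |h s| ≤ C * Real.exp (lam * s)) :
    Continuous (fun y => ∫ s in Iic y, h s) :=
  continuous_iff_continuousAt.2 fun x => (hasDerivAt_leftTail hlam hc hb x).continuousAt

/-- `deriv` of the tail primitive. [folklore] -/
theorem deriv_leftTail {h : ℝ → ℝ} {X C lam : ℝ} (hlam : 0 < lam)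
    (hc : Continuous h) (hb : ∀ s ≤ X, |h s| ≤ C * Real.exp (lam * s)) (x : ℝ) :
    deriv (fun y => ∫ s in Iic y, h s) x = h x :=
  (hasDerivAt_leftTail hlam hc hb x).deriv

/-- The tail primitive inherits the exponential bound, with constant `C/λ`; together with
`continuous_leftTail` this makes the construction iterable. [folklore] -/
theorem abs_leftTail_le' {h : ℝ → ℝ} {X C lam : ℝ} (hlam : 0 < lam)
    (hc : Continuous h) (hb : ∀ s ≤ X, |h s| ≤ C * Real.exp (lam * s)) :
    ∀ x ≤ X, |(fun y => ∫ s in Iic y, h s) x| ≤ C / lam * Real.exp (lam * x) :=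
  fun _ hx => abs_leftTail_le hlam hc hb hx

/-- **Size of the double tail**: `|∫_{(−∞,x]} ∫_{(−∞,s]} h| ≤ (C/λ²) e^{λ x}` for `x ≤ X`. [folklore] -/
theorem abs_leftTail2_le {h : ℝ → ℝ} {X C lam : ℝ} (hlam : 0 < lam)
    (hc : Continuous h) (hb : ∀ s ≤ X, |h s| ≤ C * Real.exp (lam * s)) {x : ℝ} (hx : x ≤ X) :
    |∫ s in Iic x, ∫ σ in Iic s, h σ| ≤ C / lam ^ 2 * Real.exp (lam * x) := by
  have h1 := abs_leftTail_le hlam (continuous_leftTail hlam hc hb) (abs_leftTail_le' hlam hc hb) hx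
  have : C / lam / lam = C / lam ^ 2 := by rw [div_div, sq]
  rwa [this] at h1

/-- The double tail is a primitive of the tail. [folklore] -/
theorem hasDerivAt_leftTail2 {h : ℝ → ℝ} {X C lam : ℝ} (hlam : 0 < lam)
    (hc : Continuous h) (hb : ∀ s ≤ X, |h s| ≤ C * Real.exp (lam * s)) (x : ℝ) :
    HasDerivAt (fun y => ∫ s in Iic y, ∫ σ in Iic s, h σ) (∫ σ in Iic x, h σ) x :=
  hasDerivAt_leftTail hlam (continuous_leftTail hlam hc hb) (abs_leftTail_le' hlam hc hb) x

/-- The double tail is continuous. [folklore] -/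
theorem continuous_leftTail2 {h : ℝ → ℝ} {X C lam : ℝ} (hlam : 0 < lam)
    (hc : Continuous h) (hb : ∀ s ≤ X, |h s| ≤ C * Real.exp (lam * s)) :
    Continuous (fun y => ∫ s in Iic y, ∫ σ in Iic s, h σ) :=
  continuous_leftTail hlam (continuous_leftTail hlam hc hb) (abs_leftTail_le' hlam hc hb)

/-! ### Two constants of integration: `u'' = h` on a half-line -/

/-- A function with zero derivative on an open half-line `(−∞, X')` is constant there. [folklore] -/
theorem eq_of_hasDerivAt_zero_Iio {g : ℝ → ℝ} {X' : ℝ}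
    (hg : ∀ x < X', HasDerivAt g 0 x) {x y : ℝ} (hx : x < X') (hy : y < X') : g x = g y :=
  IsOpen.is_const_of_deriv_eq_zero isOpen_Iio isPreconnected_Iio
    (fun s hs => (hg s hs).differentiableAt.differentiableWithinAt)
    (fun s hs => (hg s hs).deriv) hx hy

/-- **Two constants of integration.** If `u` is twice differentiable on the open half-line
`(−∞, X')` with `u' = v`, `v' = h` there, and `h` is continuous on `ℝ` with an exponential bound
on some `(−∞, X]`, then for some constants `α, β`:
`u x = α + β x + ∫_{(−∞,x]} ∫_{(−∞,s]} h` and `v x = β + ∫_{(−∞,x]} h` for all `x < X'`. [folklore] -/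
theorem exists_affine_add_leftTail2 {u v h : ℝ → ℝ} {X' X C lam : ℝ} (hlam : 0 < lam)
    (hc : Continuous h) (hb : ∀ s ≤ X, |h s| ≤ C * Real.exp (lam * s))
    (hu : ∀ x < X', HasDerivAt u (v x) x) (hv : ∀ x < X', HasDerivAt v (h x) x) :
    ∃ α β : ℝ, (∀ x < X', u x = α + β * x + ∫ s in Iic x, ∫ σ in Iic s, h σ) ∧
      (∀ x < X', v x = β + ∫ s in Iic x, h s) := by
  set T : ℝ → ℝ := fun y => ∫ s in Iic y, h s with hT
  set T2 : ℝ → ℝ := fun y => ∫ s in Iic y, ∫ σ in Iic s, h σ with hT2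
  have hTd : ∀ x, HasDerivAt T (h x) x := hasDerivAt_leftTail hlam hc hb
  have hT2d : ∀ x, HasDerivAt T2 (T x) x := hasDerivAt_leftTail2 hlam hc hb
  -- first constant: `v - T` has zero derivative
  set β : ℝ := v (X' - 1) - T (X' - 1) with hβ
  have hvT : ∀ x < X', v x = β + T x := by
    intro x hx
    have h0 : ∀ y < X', HasDerivAt (fun y => v y - T y) 0 y := fun y hy => by
      have h := (hv y hy).fun_sub (hTd y)
      rwa [sub_self] at h
    have := eq_of_hasDerivAt_zero_Iio h0 hx (by linarith : X' - 1 < X')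
    rw [hβ]
    linarith
  -- second constant: `u - β x - T2` has zero derivative
  set α : ℝ := u (X' - 1) - β * (X' - 1) - T2 (X' - 1) with hα
  refine ⟨α, β, fun x hx => ?_, hvT⟩
  have h0 : ∀ y < X', HasDerivAt (fun y => u y - β * y - T2 y) 0 y := fun y hy => by
    have h1 : HasDerivAt (fun y => β * y) β y := by simpa using (hasDerivAt_id y).const_mul β
    have h2 := ((hu y hy).fun_sub h1).fun_sub (hT2d y)
    rw [hvT y hy] at h2
    have e0 : β + T y - β - T y = 0 := by ring
    rwa [e0] at h2
  have := eq_of_hasDerivAt_zero_Iio h0 hx (by linarith : X' - 1 < X')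
  rw [hα]
  linarith

/-! ### Exponential bookkeeping on half-lines -/

/-- Weakening the rate of an exponential bound on a half-line `(−∞, X]`:
if `0 < μ ≤ λ` then `C e^{λ s} ≤ (C e^{(λ−μ) X}) e^{μ s}` for `s ≤ X` (`C ≥ 0`). [folklore] -/
theorem mul_exp_le_mul_exp_of_rate_le {C lam mu X s : ℝ} (hC : 0 ≤ C) (hmu : mu ≤ lam) (hs : s ≤ X) :
    C * Real.exp (lam * s) ≤ C * Real.exp ((lam - mu) * X) * Real.exp (mu * s) := by
  rw [mul_assoc, ← Real.exp_add]
  refine mul_le_mul_of_nonneg_left (Real.exp_le_exp.2 ?_) hC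
  nlinarith

/-- Sum of two exponentially bounded functions (same rate). [folklore] -/
theorem abs_add_le_mul_exp {a b C₁ C₂ lam s : ℝ} (ha : |a| ≤ C₁ * Real.exp (lam * s))
    (hb : |b| ≤ C₂ * Real.exp (lam * s)) : |a + b| ≤ (C₁ + C₂) * Real.exp (lam * s) := by
  calc |a + b| ≤ |a| + |b| := abs_add_le _ _
    _ ≤ C₁ * Real.exp (lam * s) + C₂ * Real.exp (lam * s) := add_le_add ha hb
    _ = (C₁ + C₂) * Real.exp (lam * s) := by ring

/-- Product of two exponentially bounded quantities: rates add. [folklore] -/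
theorem abs_mul_le_mul_exp_add {a b C₁ C₂ lam mu s : ℝ} (ha : |a| ≤ C₁ * Real.exp (lam * s))
    (hb : |b| ≤ C₂ * Real.exp (mu * s)) :
    |a * b| ≤ C₁ * C₂ * Real.exp ((lam + mu) * s) := by
  have hC₁ : 0 ≤ C₁ * Real.exp (lam * s) := (abs_nonneg _).trans ha
  rw [abs_mul, add_mul, Real.exp_add]
  calc |a| * |b| ≤ C₁ * Real.exp (lam * s) * (C₂ * Real.exp (mu * s)) :=
        mul_le_mul ha hb (abs_nonneg _) hC₁
    _ = C₁ * C₂ * (Real.exp (lam * s) * Real.exp (mu * s)) := by ring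

/-- A constant from an exponential bound is non-negative as soon as the bound is used once. [folklore] -/
theorem nonneg_of_abs_le_mul_exp {a C lam s : ℝ} (h : |a| ≤ C * Real.exp (lam * s)) : 0 ≤ C :=
  nonneg_of_mul_nonneg_left ((abs_nonneg a).trans h) (Real.exp_pos _)

end

end Literature.Analysis.ODE
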